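import Mathlib
import HarnessLib
import Summits.Ventures.LatticeQCDFlow.Exactness.RadialPolar
import Summits.Ventures.LatticeQCDFlow.Exactness.KickAngleJacobian
import Summits.Ventures.LatticeQCDFlow.Exactness.SphereAxisCoordinates

/-!
# The axis (latitude) disintegration of the sphere measure: `σ_{S^{n+1}} = latitudePt_* (sin^n θ dθ|_{[0,π]} ⊗ σ_{S^n})`

HONEST FRAMING: exact (Metropolis-corrected) sampling algorithms for lattice gauge theory;
figures of merit are autocorrelation/cost numbers at stated couplings and volumes; no
continuum-physics claim.

Venture `LatticeQCDFlow` (cell pub-lqcd), topic `Exactness`; FANOUT row 7 (`s0-cpn-null`: the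
S0-D1 rung — 2D CP⁹, Lüscher's LO trivializing map inside HMC, Engel–Schaefer 2011).  NEW WORK of
the cell over Mathlib (`Measure.toSphere`, `Measure.volumeIoiPow`,
`measurePreserving_homeomorphUnitSphereProd`, the planar `polarCoord` /
`lintegral_comp_polarCoord_symm`, Tonelli) and the tree's `Exactness/RadialPolar.lean`
(`dirSphere`, `lintegral_dirSphere_norm`), `Exactness/KickAngleJacobian.lean` (`polarLaw n =
sin^n θ dθ|_{[0,π]}`) and `Exactness/SphereAxisCoordinates.lean` (`axisCoords`, `latitudePt`);
nothing is cited as a fact.  Printed counterparts, NAMED ONLY: the surface-measure recursion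
`dσ_{S^{n+1}} = sin^n θ dθ dσ_{S^n}` (e.g. Folland, *Real Analysis*, §2.7 / Exercise 2.65);
Engel–Schaefer 2011 §3 eq. (18) (whose Jacobian is taken against exactly this measure).

This is the identification named NOT CLAIMED in `KickAngleJacobian.lean`, `SphereGeodesicKick.lean`
and `KickAnglePolarTHMC.lean`: with it, the printed per-site factor becomes a `HasJacobian` on the
sphere itself (`Exactness/SphereKickJacobian.lean`).

## Content (`σ_k := (volume : Measure ℝ^k).toSphere`, Mathlib's surface measure on `S^{k−1}`;
`E` a nontrivial finite-dimensional real normed space with additive Haar measure `μ`)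

* `lintegral_ball_comp_dirSphere` — cone integration: `∫_{‖x‖<1} G(x/‖x‖) dμ =
  (∫ G dμ.toSphere) / dim E`; `lintegral_eq_lintegral_toSphere_prod` — polar coordinates in
  product form `∫ h dμ = ∫ h(r • s) d(μ.toSphere ⊗ r^{dim E−1}dr)`.
* `lintegral_halfPlane_polar` — planar polar coordinates for a function vanishing on the lower
  half plane whose polar form separates; `lintegral_Ioo_ofReal_pow` (`∫_0^1 r^m dr = 1/(m+1)`).
* **`lintegral_toSphere_eq_lintegral_latitude`** — for measurable `G ≥ 0` on `S^{n+1}`: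
  `∫ G dσ_{n+2} = ∫_{w ∈ S^n} ∫_{θ ∈ (0,π)} G(latitudePt θ w) sin^n θ dθ dσ_{n+1}(w)`.  Proof:
  integrate `1_{‖x‖<1} G(x/‖x‖)` over `ℝ^{n+2}` twice — by cone integration, and in axis coordinates
  `ℝ × ℝ^{n+1}` with polar coordinates on the equator and planar polar coordinates in the (axis,
  radius) half plane (`(r cos θ, r sin θ • w) = r • latitudePt θ w`, `r (r sin θ)^n = r^{n+1} sin^n θ`);
  the radial factors `1/(n+2)` cancel.  **`toSphere_eq_map_latitudePt`** (and its `lintegral`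
  form): `σ_{n+2} = (latitudePt)_* (polarLaw n ⊗ σ_{n+1})`, no normalising constant.
* `toSphere_univ_eq_polarLaw_mul` (`|S^{n+1}| = (∫_0^π sin^n) |S^n|`), `ae_polarLaw_mem_Icc/Ioo`,
  **`map_angle_polarAxis_toSphere`**: under `σ_{n+2}` the polar angle `angle e₀ x` has law
  `|S^n| • polarLaw n` — THE POLAR ANGLE OF A UNIFORM POINT OF `S^{n+1}` HAS DENSITY `∝ sin^n θ`.

NOT CLAIMED: other axes / ambient spaces (one linear isometry away), Hausdorff-measure
identifications, anything about autocorrelations.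
-/

noncomputable section

namespace Summit.Ventures.LatticeQCDFlow.Exactness

open Real Set MeasureTheory Measure InnerProductGeometry Metric intervalIntegral
open scoped ENNReal InnerProductSpace

/-! ## §1 Two consequences of polar coordinates in a general space -/

section General

variable {E : Type*} [NormedAddCommGroup E] [NormedSpace ℝ E] [Nontrivial E] [FiniteDimensional ℝ E]
  [MeasurableSpace E] [BorelSpace E] (μ : Measure E) [μ.IsAddHaarMeasure]

/-- **Cone integration.**  For measurable `G ≥ 0` on the unit sphere,
`∫_{‖x‖<1} G(x/‖x‖) dμ = (∫ G dμ.toSphere) · (1 / dim E)` (the radial factor is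
`∫_0^1 r^{dim E − 1} dr`; written with `dim E − 1` a natural number, `(dim E − 1) + 1 = dim E`
since `E` is nontrivial). -/
theorem lintegral_ball_comp_dirSphere {G : sphere (0 : E) 1 → ℝ≥0∞} (hG : Measurable G) :
    ∫⁻ x in ball 0 1, G (dirSphere x) ∂μ =
      (∫⁻ s, G s ∂μ.toSphere) *
        ENNReal.ofReal (1 / ((Module.finrank ℝ E - 1 : ℕ) + 1 : ℝ)) := by
  have hF : Measurable fun p : sphere (0 : E) 1 × ℝ =>
      G p.1 * (Iio (1 : ℝ)).indicator (fun _ => (1 : ℝ≥0∞)) p.2 :=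
    (hG.comp measurable_fst).mul ((measurable_const.indicator measurableSet_Iio).comp measurable_snd)
  have h1 : ∫⁻ x in ball 0 1, G (dirSphere x) ∂μ =
      ∫⁻ x, G (dirSphere x) * (Iio (1 : ℝ)).indicator (fun _ => (1 : ℝ≥0∞)) ‖x‖ ∂μ := by
    rw [← lintegral_indicator measurableSet_ball]
    refine lintegral_congr fun x => ?_
    by_cases hx : ‖x‖ < 1
    · rw [indicator_of_mem (mem_ball_zero_iff.2 hx), indicator_of_mem (mem_Iio.2 hx), mul_one]
    · rw [indicator_of_notMem (fun h => hx (mem_ball_zero_iff.1 h)),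
        indicator_of_notMem (fun h => hx (mem_Iio.1 h)), mul_zero]
  rw [h1, lintegral_dirSphere_norm μ hF]
  have hg : Measurable fun r : Ioi (0 : ℝ) =>
      (Iio (1 : ℝ)).indicator (fun _ => (1 : ℝ≥0∞)) (r : ℝ) :=
    (measurable_const.indicator measurableSet_Iio).comp measurable_subtype_coe
  rw [lintegral_prod_mul hG.aemeasurable hg.aemeasurable]
  congr 1
  have hind : (fun r : Ioi (0 : ℝ) => (Iio (1 : ℝ)).indicator (fun _ => (1 : ℝ≥0∞)) (r : ℝ)) =
      (Iio (⟨1, mem_Ioi.2 one_pos⟩ : Ioi (0 : ℝ))).indicator 1 := by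
    funext r
    by_cases hr : (r : ℝ) < 1
    · have hr' : r ∈ Iio (⟨1, mem_Ioi.2 one_pos⟩ : Ioi (0 : ℝ)) := hr
      rw [indicator_of_mem (mem_Iio.2 hr), indicator_of_mem hr', Pi.one_apply]
    · have hr' : r ∉ Iio (⟨1, mem_Ioi.2 one_pos⟩ : Ioi (0 : ℝ)) := hr
      rw [indicator_of_notMem (fun h : (r : ℝ) ∈ Iio (1 : ℝ) => hr h), indicator_of_notMem hr']
  rw [hind, lintegral_indicator_one measurableSet_Iio, volumeIoiPow_apply_Iio]
  simp

/-- **Polar coordinates, product form.**  For measurable `h ≥ 0` on `E`,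
`∫ h dμ = ∫ h(r • s) d(μ.toSphere ⊗ r^{dim E − 1} dr)(s, r)` (Mathlib's
`measurePreserving_homeomorphUnitSphereProd`, through `RadialPolar.lintegral_dirSphere_norm`). -/
theorem lintegral_eq_lintegral_toSphere_prod {h : E → ℝ≥0∞} (hh : Measurable h) :
    ∫⁻ y, h y ∂μ =
      ∫⁻ p, h ((p.2 : ℝ) • (p.1 : E)) ∂(μ.toSphere.prod (volumeIoiPow (Module.finrank ℝ E - 1))) := by
  have hF : Measurable fun p : sphere (0 : E) 1 × ℝ => h (p.2 • (p.1 : E)) :=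
    hh.comp (measurable_snd.smul (measurable_subtype_coe.comp measurable_fst))
  have h1 : ∫⁻ y, h y ∂μ = ∫⁻ y, h (‖y‖ • (dirSphere y : E)) ∂μ := by
    refine lintegral_congr fun y => ?_
    by_cases hy : y = 0
    · rw [hy, norm_zero, zero_smul]
    · rw [dirSphere_coe hy, smul_smul, mul_inv_cancel₀ (norm_ne_zero_iff.2 hy), one_smul]
  rw [h1]
  exact lintegral_dirSphere_norm μ hF

end General

/-! ## §2 Planar polar coordinates on the upper half plane -/

/-- **Half-plane polar coordinates, separated form.**  If `k ≥ 0` on `ℝ²` vanishes on the closed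
lower half plane and in polar coordinates factorises as `k(r cos θ, r sin θ) = A(r) B(θ)` for
`r > 0`, `θ ∈ (0, π)`, then `∫ k = (∫_{r>0} r A(r) dr) · (∫_{θ ∈ (0,π)} B(θ) dθ)` (Mathlib's
`lintegral_comp_polarCoord_symm` and Tonelli on the rectangle `(0,∞) × (−π, π)`). -/
theorem lintegral_halfPlane_polar (k : ℝ × ℝ → ℝ≥0∞) {A B : ℝ → ℝ≥0∞} (hA : Measurable A)
    (hB : Measurable B) (hk0 : ∀ t s : ℝ, s ≤ 0 → k (t, s) = 0)
    (hk : ∀ r θ : ℝ, 0 < r → θ ∈ Ioo 0 π → k (r * cos θ, r * sin θ) = A r * B θ) :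
    ∫⁻ p, k p = (∫⁻ r in Ioi 0, ENNReal.ofReal r * A r) * ∫⁻ θ in Ioo 0 π, B θ := by
  rw [← lintegral_comp_polarCoord_symm k]
  have htarget : polarCoord.target = Ioi (0 : ℝ) ×ˢ Ioo (-π) π := rfl
  have heq : EqOn (fun q : ℝ × ℝ => ENNReal.ofReal q.1 • k (polarCoord.symm q))
      (fun q => (ENNReal.ofReal q.1 * A q.1) * (Ioo 0 π).indicator B q.2)
      (Ioi (0 : ℝ) ×ˢ Ioo (-π) π) := by
    rintro ⟨r, θ⟩ ⟨hr, hθ⟩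
    simp only [mem_Ioi, mem_Ioo] at hr hθ
    simp only [polarCoord_symm_apply, smul_eq_mul]
    by_cases hθ0 : 0 < θ
    · rw [hk r θ hr ⟨hθ0, hθ.2⟩, indicator_of_mem (show θ ∈ Ioo 0 π from ⟨hθ0, hθ.2⟩), mul_assoc]
    · have hs : r * sin θ ≤ 0 :=
        mul_nonpos_of_nonneg_of_nonpos hr.le
          (sin_nonpos_of_nonpos_of_neg_pi_le (not_lt.1 hθ0) hθ.1.le)
      rw [hk0 _ _ hs, indicator_of_notMem (fun h => hθ0 h.1), mul_zero, mul_zero]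
  rw [htarget, setLIntegral_congr_fun (measurableSet_Ioi.prod measurableSet_Ioo) heq,
    Measure.volume_eq_prod, ← Measure.prod_restrict,
    lintegral_prod_mul (f := fun r => ENNReal.ofReal r * A r) (g := (Ioo 0 π).indicator B)
      ((ENNReal.measurable_ofReal.mul hA).aemeasurable) ((hB.indicator measurableSet_Ioo).aemeasurable)]
  congr 1
  rw [lintegral_indicator measurableSet_Ioo, Measure.restrict_restrict measurableSet_Ioo,
    inter_eq_left.2 (Ioo_subset_Ioo (neg_nonpos.2 pi_pos.le) le_rfl)]

/-- `∫_{(0,1)} r^m dr = 1/(m+1)` as a Lebesgue integral of `ENNReal.ofReal`. -/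
theorem lintegral_Ioo_ofReal_pow (m : ℕ) :
    ∫⁻ r in Ioo (0 : ℝ) 1, ENNReal.ofReal (r ^ m) = ENNReal.ofReal (1 / ((m : ℝ) + 1)) := by
  rw [restrict_congr_set Ioo_ae_eq_Ioc,
    ← ofReal_integral_eq_lintegral_ofReal (intervalIntegrable_pow (μ := volume) (a := 0)
      (b := 1) (n := m)).1,
    ← integral_of_le zero_le_one, integral_pow]
  · rw [one_pow, zero_pow (Nat.succ_ne_zero m), sub_zero]
  · filter_upwards [ae_restrict_mem measurableSet_Ioc] with y hy
    exact pow_nonneg hy.1.le _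

/-! ## §3 The disintegration along the axis -/

variable (n : ℕ)

/-- For a fixed equatorial point the latitude map is continuous in the angle. -/
theorem continuous_latitudePt_left (w : sphere (0 : EuclideanSpace ℝ (Fin (n + 1))) 1) :
    Continuous fun θ : ℝ => latitudePt n θ w := by
  refine Continuous.subtype_mk ?_ _
  fun_prop

/-- For a fixed equatorial point the latitude map is measurable in the angle. -/
theorem measurable_latitudePt_left (w : sphere (0 : EuclideanSpace ℝ (Fin (n + 1))) 1) :
    Measurable fun θ : ℝ => latitudePt n θ w :=
  (continuous_latitudePt_left n w).measurable

/-- **The latitude formula for the surface measure.**  For every measurable `G ≥ 0` on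
`S^{n+1} ⊂ ℝ^{n+2}`,
`∫ G dσ_{n+2} = ∫_{w ∈ S^n} ( ∫_{θ ∈ (0,π)} G(latitudePt θ w) · sin^n θ dθ ) dσ_{n+1}(w)`,
`σ_k = (volume : Measure ℝ^k).toSphere`.  This is the surface-measure recursion
`dσ_{S^{n+1}} = sin^n θ dθ dσ_{S^n}` along the axis `e₀`. -/
theorem lintegral_toSphere_eq_lintegral_latitude
    {G : sphere (0 : EuclideanSpace ℝ (Fin (n + 2))) 1 → ℝ≥0∞} (hG : Measurable G) :
    ∫⁻ x, G x ∂(volume : Measure (EuclideanSpace ℝ (Fin (n + 2)))).toSphere =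
      ∫⁻ w, ∫⁻ θ in Ioo 0 π, G (latitudePt n θ w) * ENNReal.ofReal (sin θ ^ n) ∂volume
        ∂(volume : Measure (EuclideanSpace ℝ (Fin (n + 1)))).toSphere := by
  set Ψ := (axisCoords n).symm with hΨ
  set c : ℝ≥0∞ := ENNReal.ofReal (1 / ((n : ℝ) + 2)) with hc
  have hc0 : c ≠ 0 := (ENNReal.ofReal_pos.2 (by positivity)).ne'
  have hctop : c ≠ ∞ := ENNReal.ofReal_ne_top
  set f : EuclideanSpace ℝ (Fin (n + 2)) → ℝ≥0∞ :=
    (ball (0 : EuclideanSpace ℝ (Fin (n + 2))) 1).indicator fun x => G (dirSphere x) with hf_def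
  have hf : Measurable f := (hG.comp measurable_dirSphere).indicator measurableSet_ball
  -- (A) cone integration
  have hA : ∫⁻ x, f x ∂volume =
      (∫⁻ s, G s ∂(volume : Measure (EuclideanSpace ℝ (Fin (n + 2)))).toSphere) * c := by
    rw [hf_def, lintegral_indicator measurableSet_ball, lintegral_ball_comp_dirSphere volume hG,
      finrank_euclideanSpace_fin, show n + 2 - 1 = n + 1 by omega, hc]
    congr 2
    push_cast
    ring
  -- (B) axis coordinates, then polar coordinates on the equatorial factor
  have hB : ∫⁻ x, f x ∂volume =
      ∫⁻ p : ℝ × EuclideanSpace ℝ (Fin (n + 1)), f (Ψ p) ∂((volume : Measure ℝ).prod volume) :=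
    ((MeasurePreserving.symm (axisCoords n) (measurePreserving_axisCoords n)).lintegral_comp hf).symm
  set F : (ℝ × sphere (0 : EuclideanSpace ℝ (Fin (n + 1))) 1) × Ioi (0 : ℝ) → ℝ≥0∞ :=
    fun q => f (Ψ (q.1.1, (q.2 : ℝ) • (q.1.2 : EuclideanSpace ℝ (Fin (n + 1))))) with hF_def
  have hFm : Measurable F :=
    hf.comp (Ψ.measurable.comp ((measurable_fst.comp measurable_fst).prodMk
      ((measurable_subtype_coe.comp measurable_snd).smul
        (measurable_subtype_coe.comp (measurable_snd.comp measurable_fst)))))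
  have hC : ∀ t : ℝ, ∫⁻ y, f (Ψ (t, y)) ∂volume =
      ∫⁻ w, ∫⁻ s, F ((t, w), s) ∂(volumeIoiPow n)
        ∂(volume : Measure (EuclideanSpace ℝ (Fin (n + 1)))).toSphere := by
    intro t
    have hft : Measurable fun y : EuclideanSpace ℝ (Fin (n + 1)) => f (Ψ (t, y)) :=
      hf.comp (Ψ.measurable.comp measurable_prodMk_left)
    have hFt : Measurable fun q : sphere (0 : EuclideanSpace ℝ (Fin (n + 1))) 1 × Ioi (0 : ℝ) =>
        F ((t, q.1), q.2) :=
      hFm.comp ((measurable_const.prodMk measurable_fst).prodMk measurable_snd)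
    rw [lintegral_eq_lintegral_toSphere_prod volume hft, finrank_euclideanSpace_fin, Nat.add_sub_cancel,
      lintegral_prod _ hFt.aemeasurable]
  have hD : ∫⁻ x, f x ∂volume =
      ∫⁻ w, ∫⁻ t, ∫⁻ s, F ((t, w), s) ∂(volumeIoiPow n) ∂volume
        ∂(volume : Measure (EuclideanSpace ℝ (Fin (n + 1)))).toSphere := by
    rw [hB, lintegral_prod (fun p => f (Ψ p)) (hf.comp Ψ.measurable).aemeasurable]
    calc (∫⁻ t, ∫⁻ y, f (Ψ (t, y)) ∂volume ∂volume)
        = ∫⁻ t, ∫⁻ w, ∫⁻ s, F ((t, w), s) ∂(volumeIoiPow n)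
            ∂(volume : Measure (EuclideanSpace ℝ (Fin (n + 1)))).toSphere ∂volume :=
          lintegral_congr hC
      _ = ∫⁻ w, ∫⁻ t, ∫⁻ s, F ((t, w), s) ∂(volumeIoiPow n) ∂volume
            ∂(volume : Measure (EuclideanSpace ℝ (Fin (n + 1)))).toSphere :=
          lintegral_lintegral_swap (hFm.lintegral_prod_right').aemeasurable
  -- (C) for a fixed equatorial direction: planar polar coordinates in the (axis, radius) half plane
  have hE : ∀ w : sphere (0 : EuclideanSpace ℝ (Fin (n + 1))) 1,
      ∫⁻ t, ∫⁻ s, F ((t, w), s) ∂(volumeIoiPow n) ∂volume =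
        c * ∫⁻ θ in Ioo 0 π, G (latitudePt n θ w) * ENNReal.ofReal (sin θ ^ n) := by
    intro w
    set k : ℝ × ℝ → ℝ≥0∞ := (Prod.snd ⁻¹' Ioi (0 : ℝ)).indicator fun p =>
      ENNReal.ofReal (p.2 ^ n) * f (Ψ (p.1, p.2 • (w : EuclideanSpace ℝ (Fin (n + 1))))) with hk_def
    have hkm : Measurable k := by
      refine Measurable.indicator ?_ (measurable_snd measurableSet_Ioi)
      exact (ENNReal.measurable_ofReal.comp (measurable_snd.pow_const n)).mul
        (hf.comp (Ψ.measurable.comp (measurable_fst.prodMk (measurable_snd.smul_const _))))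
    have hk_apply : ∀ t s : ℝ, k (t, s) = (Ioi (0 : ℝ)).indicator
        (fun s => ENNReal.ofReal (s ^ n) *
          f (Ψ (t, s • (w : EuclideanSpace ℝ (Fin (n + 1)))))) s := fun t s => rfl
    have h1 : ∀ t : ℝ, ∫⁻ s, F ((t, w), s) ∂(volumeIoiPow n) = ∫⁻ s, k (t, s) ∂volume := by
      intro t
      have hd : Measurable fun r : Ioi (0 : ℝ) => ENNReal.ofReal (r.1 ^ n) :=
        ENNReal.measurable_ofReal.comp (measurable_subtype_coe.pow_const n)
      have hg : Measurable fun s : Ioi (0 : ℝ) => F ((t, w), s) :=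
        hFm.comp (measurable_const.prodMk measurable_id)
      simp_rw [hk_apply]
      rw [lintegral_indicator measurableSet_Ioi, ← lintegral_subtype_comap measurableSet_Ioi,
        volumeIoiPow, lintegral_withDensity_eq_lintegral_mul _ hd hg]
      rfl
    simp_rw [h1]
    rw [← lintegral_prod _ hkm.aemeasurable, ← Measure.volume_eq_prod]
    have hlat : Measurable fun θ : ℝ => G (latitudePt n θ w) :=
      hG.comp (measurable_latitudePt_left n w)
    rw [lintegral_halfPlane_polar k
      ((measurable_const.indicator measurableSet_Iio).mul
        (ENNReal.measurable_ofReal.comp (measurable_id.pow_const n)))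
      (hlat.mul (ENNReal.measurable_ofReal.comp (measurable_sin.pow_const n)))
      (A := fun r => (Iio (1 : ℝ)).indicator (fun _ => (1 : ℝ≥0∞)) r * ENNReal.ofReal (r ^ n))
      (B := fun θ => G (latitudePt n θ w) * ENNReal.ofReal (sin θ ^ n))]
    · congr 1 -- the radial factor `∫_0^1 r^{n+1} dr = 1/(n+2)`
      have hrad : EqOn (fun r : ℝ => ENNReal.ofReal r *
            ((Iio (1 : ℝ)).indicator (fun _ => (1 : ℝ≥0∞)) r * ENNReal.ofReal (r ^ n)))
          (fun r => (Iio (1 : ℝ)).indicator (fun r => ENNReal.ofReal (r ^ (n + 1))) r) (Ioi 0) := by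
        intro r hr
        simp only [mem_Ioi] at hr
        by_cases h1 : r < 1
        · simp only [indicator_of_mem (mem_Iio.2 h1), one_mul]
          rw [← ENNReal.ofReal_mul hr.le, pow_succ']
        · simp only [indicator_of_notMem (fun h => h1 (mem_Iio.1 h)), zero_mul, mul_zero]
      rw [setLIntegral_congr_fun measurableSet_Ioi hrad, lintegral_indicator measurableSet_Iio,
        Measure.restrict_restrict measurableSet_Iio, inter_comm, Ioi_inter_Iio, lintegral_Ioo_ofReal_pow,
        hc]
      congr 1
      push_cast
      ring
    · intro t s hs -- `k` vanishes on the lower half plane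
      rw [hk_apply, indicator_of_notMem (fun h => not_lt.2 hs (mem_Ioi.1 h))]
    · intro r θ hr hθ -- the polar form of `k` separates
      have hs : 0 < r * sin θ := mul_pos hr (sin_pos_of_pos_of_lt_pi hθ.1 hθ.2)
      rw [hk_apply, indicator_of_mem (mem_Ioi.2 hs), axisCoords_symm_polar, hf_def]
      have hnorm : ‖r • (latitudePt n θ w : EuclideanSpace ℝ (Fin (n + 2)))‖ = r := by
        rw [norm_smul, norm_eq_of_mem_sphere, mul_one, Real.norm_eq_abs, abs_of_pos hr]
      by_cases h1 : r < 1
      · rw [indicator_of_mem (mem_ball_zero_iff.2 (hnorm.trans_lt h1)), dirSphere_smul_coe hr,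
          indicator_of_mem (mem_Iio.2 h1), one_mul, mul_pow,
          ENNReal.ofReal_mul (pow_nonneg hr.le n)]
        ring
      · rw [indicator_of_notMem (fun h => h1 (hnorm.symm.trans_lt (mem_ball_zero_iff.1 h))),
          indicator_of_notMem (fun h => h1 (mem_Iio.1 h)), zero_mul, zero_mul, mul_zero]
  -- (D) assemble and cancel the radial constant
  simp_rw [hE] at hD
  rw [lintegral_const_mul' c _ hctop, hA, mul_comm] at hD
  exact (ENNReal.mul_right_inj hc0 hctop).1 hD

/-- `polarLaw n`-almost every angle lies in `[0, π]`. -/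
theorem ae_polarLaw_mem_Icc : ∀ᵐ θ ∂(polarLaw n), θ ∈ Icc 0 π := by
  unfold polarLaw
  exact (withDensity_absolutelyContinuous _ _).ae_le (ae_restrict_mem measurableSet_Icc)

/-- `polarLaw n`-almost every angle lies in `(0, π)` (the poles are Lebesgue-null). -/
theorem ae_polarLaw_mem_Ioo : ∀ᵐ θ ∂(polarLaw n), θ ∈ Ioo 0 π := by
  unfold polarLaw
  rw [← restrict_congr_set Ioo_ae_eq_Icc]
  exact (withDensity_absolutelyContinuous _ _).ae_le (ae_restrict_mem measurableSet_Ioo)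

/-- **The latitude formula, product form**: for measurable `G ≥ 0` on `S^{n+1}`,
`∫ G dσ_{n+2} = ∫ G(latitudePt θ w) d(polarLaw n ⊗ σ_{n+1})(θ, w)`. -/
theorem lintegral_toSphere_eq_lintegral_prod_latitude
    {G : sphere (0 : EuclideanSpace ℝ (Fin (n + 2))) 1 → ℝ≥0∞} (hG : Measurable G) :
    ∫⁻ x, G x ∂(volume : Measure (EuclideanSpace ℝ (Fin (n + 2)))).toSphere =
      ∫⁻ p, G (latitudePt n p.1 p.2)
        ∂((polarLaw n).prod (volume : Measure (EuclideanSpace ℝ (Fin (n + 1)))).toSphere) := by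
  haveI : SFinite (polarLaw n) := by unfold polarLaw; infer_instance
  have hGl : Measurable fun p : ℝ × sphere (0 : EuclideanSpace ℝ (Fin (n + 1))) 1 =>
      G (latitudePt n p.1 p.2) := hG.comp (measurable_latitudePt n)
  have hd : Measurable fun θ : ℝ => ENNReal.ofReal (sin θ ^ n) :=
    ENNReal.measurable_ofReal.comp (measurable_sin.pow_const n)
  rw [lintegral_toSphere_eq_lintegral_latitude n hG, lintegral_prod _ hGl.aemeasurable, polarLaw,
    lintegral_withDensity_eq_lintegral_mul _ hd hGl.lintegral_prod_right',
    ← restrict_congr_set Ioo_ae_eq_Icc]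
  have hswap :
      (∫⁻ w, ∫⁻ θ in Ioo 0 π, G (latitudePt n θ w) * ENNReal.ofReal (sin θ ^ n) ∂volume
          ∂(volume : Measure (EuclideanSpace ℝ (Fin (n + 1)))).toSphere) =
        ∫⁻ θ in Ioo 0 π, ∫⁻ w, G (latitudePt n θ w) * ENNReal.ofReal (sin θ ^ n)
          ∂(volume : Measure (EuclideanSpace ℝ (Fin (n + 1)))).toSphere ∂volume :=
    lintegral_lintegral_swap ((hGl.comp measurable_swap).mul (hd.comp measurable_snd)).aemeasurable
  rw [hswap]
  refine lintegral_congr fun θ => ?_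
  rw [Pi.mul_apply, ← lintegral_const_mul' _ _ ENNReal.ofReal_ne_top]
  exact lintegral_congr fun w => mul_comm _ _

/-- **The axis disintegration of the surface measure.**  On `S^{n+1} ⊂ ℝ^{n+2}`,
`σ_{n+2} = (latitudePt)_* (polarLaw n ⊗ σ_{n+1})`: Mathlib's surface measure of `S^{n+1}` is the
push-forward, under `(θ, w) ↦ cos θ • e₀ + sin θ • (0, w)`, of the product of the polar law
`sin^n θ dθ|_{[0,π]}` and the surface measure of the equator `S^n` — with no normalising
constant. -/
theorem toSphere_eq_map_latitudePt :
    (volume : Measure (EuclideanSpace ℝ (Fin (n + 2)))).toSphere =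
      ((polarLaw n).prod (volume : Measure (EuclideanSpace ℝ (Fin (n + 1)))).toSphere).map
        fun p => latitudePt n p.1 p.2 := by
  refine Measure.ext_of_lintegral _ fun G hG => ?_
  rw [lintegral_map hG (measurable_latitudePt n), lintegral_toSphere_eq_lintegral_prod_latitude n hG]

/-- **`|S^{n+1}| = (∫_0^π sin^n θ dθ) · |S^n|`** for Mathlib's surface measures (the total masses
of the disintegration). -/
theorem toSphere_univ_eq_polarLaw_mul :
    (volume : Measure (EuclideanSpace ℝ (Fin (n + 2)))).toSphere univ =
      polarLaw n univ * (volume : Measure (EuclideanSpace ℝ (Fin (n + 1)))).toSphere univ := by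
  haveI : SFinite (polarLaw n) := by unfold polarLaw; infer_instance
  rw [toSphere_eq_map_latitudePt n, Measure.map_apply (measurable_latitudePt n) MeasurableSet.univ,
    preimage_univ, ← univ_prod_univ, Measure.prod_prod]

/-- The polar angle from the axis is a measurable function on the sphere. -/
theorem measurable_angle_polarAxis :
    Measurable fun x : sphere (0 : EuclideanSpace ℝ (Fin (n + 2))) 1 =>
      angle (polarAxis n) (x : EuclideanSpace ℝ (Fin (n + 2))) := by
  have h1 : Continuous fun x : sphere (0 : EuclideanSpace ℝ (Fin (n + 2))) 1 =>
      ⟪polarAxis n, (x : EuclideanSpace ℝ (Fin (n + 2)))⟫_ℝ :=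
    continuous_const.inner continuous_subtype_val
  have h2 : Continuous fun x : sphere (0 : EuclideanSpace ℝ (Fin (n + 2))) 1 =>
      ‖polarAxis n‖ * ‖(x : EuclideanSpace ℝ (Fin (n + 2)))‖ :=
    continuous_const.mul (continuous_norm.comp continuous_subtype_val)
  exact Real.continuous_arccos.measurable.comp (h1.measurable.div h2.measurable)

/-- **The law of the polar angle.**  Under the surface measure of `S^{n+1}`, the polar angle
`angle e₀ x ∈ [0, π]` is distributed by `|S^n| • polarLaw n`, i.e. with density proportional to
`sin^n θ` on `[0, π]` (for the CP(N−1) site sphere `S^{2N−1}`: `sin^{2N−2} θ`). -/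
theorem map_angle_polarAxis_toSphere :
    ((volume : Measure (EuclideanSpace ℝ (Fin (n + 2)))).toSphere).map
        (fun x : sphere (0 : EuclideanSpace ℝ (Fin (n + 2))) 1 =>
          angle (polarAxis n) (x : EuclideanSpace ℝ (Fin (n + 2)))) =
      (volume : Measure (EuclideanSpace ℝ (Fin (n + 1)))).toSphere univ • polarLaw n := by
  haveI : SFinite (polarLaw n) := by unfold polarLaw; infer_instance
  rw [toSphere_eq_map_latitudePt n,
    Measure.map_map (measurable_angle_polarAxis n) (measurable_latitudePt n)]
  have hae : ((fun x : sphere (0 : EuclideanSpace ℝ (Fin (n + 2))) 1 =>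
        angle (polarAxis n) (x : EuclideanSpace ℝ (Fin (n + 2)))) ∘
        fun p : ℝ × sphere (0 : EuclideanSpace ℝ (Fin (n + 1))) 1 => latitudePt n p.1 p.2)
      =ᵐ[(polarLaw n).prod (volume : Measure (EuclideanSpace ℝ (Fin (n + 1)))).toSphere]
      Prod.fst := by
    filter_upwards [quasiMeasurePreserving_fst.ae (ae_polarLaw_mem_Icc n)] with p hp
    exact angle_polarAxis_latitudePt n hp p.2
  rw [Measure.map_congr hae, Measure.map_fst_prod]

end Summit.Ventures.LatticeQCDFlow.Exactness

end
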